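import Summits.QuantumFields.BalabanUV.Beta.SpineRootedBm
import Summits.QuantumFields.BalabanUV.Beta.AxialCoordinateProjectorCoarseRules

/-!
# `hR` for the centred block-mean-dressed spine over the COARSE coordinate projector `axEc` — the non-vacuous re-issue of the gen-12
# wiring `SpineRooted.axisReflectionCovariant_flipK_TbalOf_JsBalBmAtOf_ctr` (β sub-cell, row BETA-an2, gen 13; NOTE X-an2-43)

HONEST FRAMING (cell charter, verbatim): «discharging BetaPertH makes Balaban's UV stability UNCONDITIONAL — a real
constructive-QFT result; it is NOT the continuum limit and NOT the Clay problem.»  DERIVED cell leaf (pub-balaban β sub-cell, lane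
an2 gen 13); no statement of Bałaban's papers is typed here, no `[cite:]` tag, no `Prop` fact; it instantiates no binder of the
β-function wall by itself.  NOT `BetaPertH`; NOT continuum; NOT Clay.

## What is here
The gen-12 wiring theorem took rules 3–4 of `RelInv G_j (𝕄 j) (axE ctr Lc)` as hypotheses h3/h4; `AxialCoordinateProjectorCoarse` §2 shows these
are UNSATISFIABLE for `Lc ≥ 2` (the multiplier block of `axE` is the identity at every site, the packed resolvents live on the coarse
sublattice).  This file re-issues the SAME wiring over the repaired projector `axEc ctr Lc` (multiplier block = identity on the coarse
sites): **`axisReflectionCovariant_flipK_TbalOf_JsBalBmAtOf_ctrC`** — `∀ j, AxisReflectionCovariant (flipK (TbalOf Lc (JsBalBmAtOf …) j))`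
from EXACTLY: a spread `𝕄 j` with h3 `(G_j∘𝕄 j)∘axEc = axEc` and h4 `(axEc∘𝕄 j)∘G_j = axEc`, `G_j := coDressKBmAt ctr Lc (KInvStep Lc j)`;
contact families commuting with `axEc`; and the conjugated jet laws (Sr-conj)/(Wr-conj) of the UNDRESSED spine against `𝕄 j`.  Rules 1–2
are discharged inside by `axEc_rules_coDressKBmAt_KInvStep`, reflection invariance of `G_j` by `refK_coDressKBmAt_KInvStep`, and `hSt`/`hWt`
by the undressed spine's translation laws — all BY NAME.  AT `j = 0` the sockets h3/h4 ARE DISCHARGED with `𝕄 0 := BorderedHessian.bhK Lc`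
by `BorderedHessian.rule3_KInvStep_zero` / `rule4_KInvStep_zero` (`RelInvBorderedHessian`, same lane); `j ≥ 1` remains a binder.

All declarations `[folklore]`; axioms standard.  Provenance: b2b-balaban β sub-cell, unit beta-an2 gen 13, 2026-08-20 (v1); over `SpineRootedBm`,
`AxialDressingRootedBmHessian`, `AxialCoordinateProjectorCoarse(Rules)` BY NAME; no existing file touched.
-/

open Finset
open scoped BigOperators
open Literature.MathematicalPhysics.QuantumFieldTheory
open Literature.MathematicalPhysics.QuantumFieldTheory.Balaban1983to89
open Literature.MathematicalPhysics.QuantumFieldTheory.Balaban1983to89.Beta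
open B12Sec2to5 (l1 l1_nonneg)
open ExpKernelCalculus (MKer Decays BiLoc comp tr VertexFamily VertexFamily₂ shiftK)
open AffineAveraging (Form1 Form2 box toSite)
open AveragingContoursRooted (ctrOff ctrOff_mem_box)
open PolarizationSign (reflSign AxisReflectionCovariant)
open KernelReflection (refK)
open ResolventReflection (bref Φ)
open OneStepResolventKernel (Fib LocStencil JetData)
open OneStepKernelFamily (KInvStep vertexOfK TbalOf flipK)
open Summit.QuantumFields.BalabanUV.Beta.TameKernelCalculus
open Summit.QuantumFields.BalabanUV.Beta.ChartConjugation (conjV conjW)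
open Summit.QuantumFields.BalabanUV.Beta.ChartConjugationRelative (RelInv)
open Summit.QuantumFields.BalabanUV.Beta.AxialDressingRooted (dressBmAt coDressKBmAt axEc spr_axEc axEc_rules_coDressKBmAt_KInvStep
  axisReflectionCovariant_flipK_TbalOf_dressBmCtr_rel one_le_of_neZero)

namespace Summit.QuantumFields.BalabanUV.Beta.SpineRooted

noncomputable section

/-- [folklore] **`hR` FOR THE CENTRED BLOCK-MEAN-DRESSED SPINE OVER THE COARSE COORDINATE PROJECTOR**: the gen-12 wiring
`axisReflectionCovariant_flipK_TbalOf_JsBalBmAtOf_ctr` with `axE ↦ axEc` everywhere — satisfiable sockets (rules 1–2 of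
`RelInv G_j (𝕄 j) (axEc ctr Lc)` discharged inside by `axEc_rules_coDressKBmAt_KInvStep`; at `j = 0`, h3/h4 hold with `𝕄 0 := bhK Lc`,
`BorderedHessian.rule3_KInvStep_zero` / `rule4_KInvStep_zero`).  Discharges nothing of the wall by itself. -/
theorem axisReflectionCovariant_flipK_TbalOf_JsBalBmAtOf_ctrC {Lc : ℕ} [NeZero Lc] (hLc : Odd Lc) (cE cVH cΛ : ℝ)
    (W : ℕ → Fin 4 → (Fin 4 → ℤ) → Fin 4 → (Fin 4 → ℤ) → MKer 4 (Fib 3)) (Cw δw : ℕ → ℝ) (hδw : ∀ j, 0 < δw j)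
    (hW : ∀ j, VertexFamily₂ (W j) Lc (Cw j) (δw j))
    (hWt : ∀ (j : ℕ) (μ : Fin 4) (y : Fin 4 → ℤ) (ν : Fin 4) (y' t : Fin 4 → ℤ),
      W j μ (y + t) ν (y' + t) = shiftK (-((Lc : ℤ) • t)) (W j μ y ν y'))
    (M : ℕ → MKer 4 (Fib 3)) (hM : ∀ j, Spr (M j))
    (h3 : ∀ j, comp (comp (coDressKBmAt (toSite (ctrOff 4 Lc)) Lc (KInvStep (d := 3) Lc j)) (M j)) (axEc (toSite (ctrOff 4 Lc)) Lc) =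
      axEc (toSite (ctrOff 4 Lc)) Lc)
    (h4 : ∀ j, comp (comp (axEc (toSite (ctrOff 4 Lc)) Lc) (M j)) (coDressKBmAt (toSite (ctrOff 4 Lc)) Lc (KInvStep (d := 3) Lc j)) =
      axEc (toSite (ctrOff 4 Lc)) Lc)
    (C : ℕ → Fin 4 → Fin 4 → (Fin 4 → ℤ) → MKer 4 (Fib 3)) (Cc δc : ℕ → ℝ) (hC : ∀ j α, LocStencil (C j α) (Cc j) (δc j))
    (hδc : ∀ j, 0 < δc j) (X₂ : ℕ → Fin 4 → Fin 4 → (Fin 4 → ℤ) → Fin 4 → (Fin 4 → ℤ) → MKer 4 (Fib 3))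
    (hX₂ : ∀ j α μ y ν y', Loc (X₂ j α μ y ν y'))
    (hEC : ∀ j α κ' u, comp (axEc (toSite (ctrOff 4 Lc)) Lc) (C j α κ' u) = comp (C j α κ' u) (axEc (toSite (ctrOff 4 Lc)) Lc))
    (hEX₂ : ∀ j α μ y ν y', comp (axEc (toSite (ctrOff 4 Lc)) Lc) (X₂ j α μ y ν y') = comp (X₂ j α μ y ν y') (axEc (toSite (ctrOff 4 Lc)) Lc))
    (hSrC : ∀ (j : ℕ) (α κ' : Fin 4) (u : Fin 4 → ℤ),
      (JsBal0AtOf (d := 3) hLc.pos (ctrOff_mem_box hLc.pos) cE cVH cΛ W Cw δw hδw hW j).S κ' (bref α κ' u) =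
        reflSign α κ' • refK (Φ Lc α)
          ((JsBal0AtOf (d := 3) hLc.pos (ctrOff_mem_box hLc.pos) cE cVH cΛ W Cw δw hδw hW j).S κ' u + conjV (M j) (C j α κ' u)))
    (hWrC : ∀ (j : ℕ) (α μ : Fin 4) (y : Fin 4 → ℤ) (ν : Fin 4) (y' : Fin 4 → ℤ),
      (JsBal0AtOf (d := 3) hLc.pos (ctrOff_mem_box hLc.pos) cE cVH cΛ W Cw δw hδw hW j).W μ (bref α μ y) ν (bref α ν y') =
        (reflSign α μ * reflSign α ν) • refK (Φ Lc α)
          ((JsBal0AtOf (d := 3) hLc.pos (ctrOff_mem_box hLc.pos) cE cVH cΛ W Cw δw hδw hW j).W μ y ν y' +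
            conjW (M j)
              (vertexOfK (coDressKBmAt (toSite (ctrOff 4 Lc)) Lc (KInvStep (d := 3) Lc j)) Lc
                (JsBal0AtOf (d := 3) hLc.pos (ctrOff_mem_box hLc.pos) cE cVH cΛ W Cw δw hδw hW j).S μ y)
              (vertexOfK (coDressKBmAt (toSite (ctrOff 4 Lc)) Lc (KInvStep (d := 3) Lc j)) Lc
                (JsBal0AtOf (d := 3) hLc.pos (ctrOff_mem_box hLc.pos) cE cVH cΛ W Cw δw hδw hW j).S ν y')
              (vertexOfK (coDressKBmAt (toSite (ctrOff 4 Lc)) Lc (KInvStep (d := 3) Lc j)) Lc (C j α) μ y)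
              (vertexOfK (coDressKBmAt (toSite (ctrOff 4 Lc)) Lc (KInvStep (d := 3) Lc j)) Lc (C j α) ν y') (X₂ j α μ y ν y'))) :
    ∀ j : ℕ, AxisReflectionCovariant
      (flipK (TbalOf Lc (JsBalBmAtOf (d := 3) hLc.pos (ctrOff_mem_box hLc.pos) cE cVH cΛ W Cw δw hδw hW) j)) := by
  have hR : ∀ j, RelInv (coDressKBmAt (toSite (ctrOff 4 Lc)) Lc (KInvStep (d := 3) Lc j)) (M j) (axEc (toSite (ctrOff 4 Lc)) Lc) :=
    fun j => ⟨(axEc_rules_coDressKBmAt_KInvStep (ctrOff_mem_box (one_le_of_neZero Lc)) j).1,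
      (axEc_rules_coDressKBmAt_KInvStep (ctrOff_mem_box (one_le_of_neZero Lc)) j).2, h3 j, h4 j⟩
  exact axisReflectionCovariant_flipK_TbalOf_dressBmCtr_rel hLc
    (JsBal0AtOf (d := 3) hLc.pos (ctrOff_mem_box hLc.pos) cE cVH cΛ W Cw δw hδw hW) M (axEc (toSite (ctrOff 4 Lc)) Lc) hM
    (spr_axEc _ _) hR (JsBal0AtOf_S_translate hLc.pos (ctrOff_mem_box hLc.pos) cE cVH cΛ W Cw δw hδw hW)
    (JsBal0AtOf_W_translate hLc.pos (ctrOff_mem_box hLc.pos) cE cVH cΛ W Cw δw hδw hW hWt) C Cc δc hC hδc X₂ hX₂ hEC hEX₂ hSrC hWrC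

end

end Summit.QuantumFields.BalabanUV.Beta.SpineRooted
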